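import Mathlib.LinearAlgebra.Basis.VectorSpace
import Mathlib.Analysis.Calculus.Deriv.Mul
import Literature.NumberTheory.Automorphic.RealMatrixGroupCharacterSmooth
import HarnessLib

/-!
# The differential of a continuous character is a Lie-algebra character

For a real matrix group `H ≤ GL_N(A)` (`RealMatrixGroup`) and a character `χ : H →* ℂ` with a
DIFFERENTIAL `δ : 𝔥 →ₗ[ℝ] ℂ`, `χ (exp X) = e^{δ X}` (every continuous character has one:
`RealMatrixGroup.exists_character_differential`), we prove the two classical facts

* `RealMatrixGroup.differential_Ad` — `δ (Ad g X) = δ X`: conjugating the one-parameter group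
  `t ↦ exp (tX)` by `g` does not change `χ` along it (`χ` takes values in a commutative group), and the
  derivative at `t = 0` of `t ↦ e^{t a}` determines `a`;
* `RealMatrixGroup.differential_lie` — `δ ⁅Y, X⁆ = 0`: differentiate `s ↦ δ (Ad (exp sY) X) = δ X` at
  `s = 0`, using `d/ds (e^{sY} X e^{-sY})|₀ = YX - XY` (product rule for `NormedSpace.exp`).

Hence `δ` vanishes on `[𝔥, 𝔥]`; in particular a character of `U(p,q)` has a differential killing
`𝔭 ⊂ 𝔰𝔲(p,q) = [𝔲(p,q), 𝔲(p,q)]`, which is what makes character twists of archimedean Weil data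
harmless for the `𝔭₋`-annihilation of harmonic vectors.

All statements are kernel-proved; the citations record provenance only: Knapp, *Lie Groups Beyond an
Introduction*, I.§10, (1.82)–(1.89) (`Ad`, `exp` and conjugation; the differential of a smooth
homomorphism is a Lie algebra homomorphism). [Knapp2002]
-/

namespace Literature.NumberTheory.Automorphic

open scoped MatrixGroups Matrix Topology

attribute [local instance 100] LieRing.ofAssociativeRing

namespace RealMatrixGroup

variable {A : Type*} [NormedCommRing A] [NormedAlgebra ℝ A] [NormedAlgebra ℚ A] [CompleteSpace A] [StarRing A]
  {N : Type*} [Fintype N] [DecidableEq N] (H : RealMatrixGroup A N)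

set_option backward.isDefEq.respectTransparency false in
open scoped Matrix.Norms.Operator in
/-- `exp (t · Ad g X) · g = g · exp (tX)` in `H` (`Matrix.exp_units_conj`). Knapp, I.§10, Prop. 1.89.
[folklore] -/
theorem expMem_smul_Ad_mul (g : H.carrier) (X : H.lie) (t : ℝ) :
    H.expMem (t • H.Ad g X) * g = g * H.expMem (t • X) := by
  refine Subtype.ext (Units.ext ?_)
  change NormedSpace.exp (t • (((g : GL N A) : Matrix N N A) * (X : Matrix N N A) *
      (((g : GL N A)⁻¹ : GL N A) : Matrix N N A))) * ((g : GL N A) : Matrix N N A) =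
    ((g : GL N A) : Matrix N N A) * NormedSpace.exp (t • (X : Matrix N N A))
  rw [← Matrix.smul_mul, ← Matrix.mul_smul, Matrix.exp_units_conj, Matrix.mul_assoc,
    Matrix.mul_assoc, Units.inv_mul, Matrix.mul_one]

/-- Along a conjugated one-parameter group a character does not change:
`χ (exp (t · Ad g X)) = χ (exp (tX))`. [folklore] -/
theorem character_expMem_smul_Ad (χ : H.carrier →* ℂ) (g : H.carrier) (X : H.lie) (t : ℝ) :
    χ (H.expMem (t • H.Ad g X)) = χ (H.expMem (t • X)) := by
  have h := congrArg χ (H.expMem_smul_Ad_mul g X t)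
  rw [map_mul, map_mul, mul_comm (χ g)] at h
  exact mul_right_cancel₀ (by simpa using (χ.toHomUnits g).ne_zero) h

/-- The exponent of `t ↦ e^{t a}` is determined by the function (derivative at `0`). [folklore] -/
theorem eq_of_cexp_mul_eq {a b : ℂ} (h : ∀ t : ℝ, Complex.exp ((t : ℂ) * a) = Complex.exp ((t : ℂ) * b)) :
    a = b := by
  have h1 : HasDerivAt (fun t : ℝ => Complex.exp ((t : ℂ) * a)) a 0 := by
    simpa using ((Complex.ofRealCLM.hasDerivAt (x := (0 : ℝ))).mul_const a).cexp
  have h2 : HasDerivAt (fun t : ℝ => Complex.exp ((t : ℂ) * a)) b 0 := by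
    rw [show (fun t : ℝ => Complex.exp ((t : ℂ) * a)) = fun t : ℝ => Complex.exp ((t : ℂ) * b) from
      funext h]
    simpa using ((Complex.ofRealCLM.hasDerivAt (x := (0 : ℝ))).mul_const b).cexp
  exact h1.unique h2

/-- **The differential of a character is `Ad`-invariant**: if `χ (exp X) = e^{δ X}` for all `X ∈ 𝔥`
then `δ (Ad g X) = δ X`. Knapp, I.§10, (1.88)–(1.89). [folklore] -/
theorem differential_Ad {χ : H.carrier →* ℂ} {δ : H.lie →ₗ[ℝ] ℂ}
    (hδ : ∀ X : H.lie, χ (H.expMem X) = Complex.exp (δ X)) (g : H.carrier) (X : H.lie) :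
    δ (H.Ad g X) = δ X := by
  refine eq_of_cexp_mul_eq fun t => ?_
  have e1 := hδ (t • H.Ad g X)
  have e2 := hδ (t • X)
  rw [map_smul, Complex.real_smul] at e1 e2
  rw [← e1, ← e2, H.character_expMem_smul_Ad χ g X t]

section Bracket

set_option backward.isDefEq.respectTransparency false in
open scoped Matrix.Norms.Operator in
/-- `d/ds (e^{sY} X e^{-sY})|_{s=0} = YX - XY` as matrices. Knapp, I.§10, (1.82). [folklore] -/
theorem hasDerivAt_coe_Ad_expMem_smul (X Y : H.lie) :
    HasDerivAt (fun s : ℝ => (H.Ad (H.expMem (s • Y)) X : Matrix N N A))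
      ((Y : Matrix N N A) * X - X * Y) 0 := by
  have hf : ∀ s : ℝ, (H.Ad (H.expMem (s • Y)) X : Matrix N N A) =
      NormedSpace.exp (s • (Y : Matrix N N A)) * (X : Matrix N N A) *
        NormedSpace.exp (s • (-(Y : Matrix N N A))) := by
    intro s
    rw [Ad_apply_coe, coe_expMem, ← expGL_neg, coe_expGL, coe_expGL]
    change NormedSpace.exp (s • (Y : Matrix N N A)) * (X : Matrix N N A) *
        NormedSpace.exp (-(s • (Y : Matrix N N A))) = _
    rw [smul_neg]
  simp_rw [hf]
  have h1 : HasDerivAt (fun s : ℝ => NormedSpace.exp (s • (Y : Matrix N N A)))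
      (NormedSpace.exp ((0 : ℝ) • (Y : Matrix N N A)) * (Y : Matrix N N A)) 0 :=
    hasDerivAt_exp_smul_const (𝕂 := ℝ) (Y : Matrix N N A) 0
  have h2 : HasDerivAt (fun s : ℝ => NormedSpace.exp (s • (-(Y : Matrix N N A))))
      (NormedSpace.exp ((0 : ℝ) • (-(Y : Matrix N N A))) * (-(Y : Matrix N N A))) 0 :=
    hasDerivAt_exp_smul_const (𝕂 := ℝ) (-(Y : Matrix N N A)) 0
  have h := (h1.mul_const (X : Matrix N N A)).mul h2
  simp only [zero_smul, NormedSpace.exp_zero, one_mul, mul_one] at h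
  refine (h.congr_deriv ?_).congr_of_eventuallyEq (Filter.Eventually.of_forall fun s => rfl)
  rw [Matrix.mul_neg, sub_eq_add_neg]

variable [FiniteDimensional ℝ A]

set_option backward.isDefEq.respectTransparency false in
open scoped Matrix.Norms.Operator in
/-- **The differential of a character kills brackets**: if `χ (exp X) = e^{δ X}` on `𝔥` then
`δ ⁅Y, X⁆ = 0`. Knapp, I.§10, Prop. 1.89 (the differential of a smooth homomorphism is a Lie algebra
homomorphism; here the target `ℂ` is commutative). [folklore] -/
theorem differential_lie {χ : H.carrier →* ℂ} {δ : H.lie →ₗ[ℝ] ℂ}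
    (hδ : ∀ X : H.lie, χ (H.expMem X) = Complex.exp (δ X)) (Y X : H.lie) : δ ⁅Y, X⁆ = 0 := by
  -- extend `δ` to a (continuous) real-linear functional `Δ` on all matrices
  let δ' : H.lie.toSubmodule →ₗ[ℝ] ℂ :=
    { toFun := fun Z => δ ⟨(Z : Matrix N N A), Z.2⟩
      map_add' := fun Z Z' => by rw [← map_add]; rfl
      map_smul' := fun r Z => by rw [RingHom.id_apply, ← map_smul]; rfl }
  obtain ⟨Δ, hΔ⟩ := LinearMap.exists_extend δ'
  have hΔδ : ∀ Z : H.lie, Δ (Z : Matrix N N A) = δ Z := fun Z => by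
    have := LinearMap.congr_fun hΔ ⟨(Z : Matrix N N A), Z.2⟩
    simpa [δ'] using this
  let ΔL : Matrix N N A →L[ℝ] ℂ := ⟨Δ, Δ.continuous_of_finiteDimensional⟩
  -- `s ↦ Δ (Ad (exp sY) X) = δ X` is constant, with derivative `Δ (YX - XY)` at `0`
  have hconst : ∀ s : ℝ, ΔL (H.Ad (H.expMem (s • Y)) X : Matrix N N A) = δ X := fun s => by
    change Δ _ = _
    rw [hΔδ, H.differential_Ad hδ]
  have hD : HasDerivAt (fun s : ℝ => ΔL (H.Ad (H.expMem (s • Y)) X : Matrix N N A))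
      (ΔL ((Y : Matrix N N A) * X - X * Y)) 0 :=
    (ΔL.hasFDerivAt.comp_hasDerivAt 0 (H.hasDerivAt_coe_Ad_expMem_smul X Y))
  have hD0 : HasDerivAt (fun s : ℝ => ΔL (H.Ad (H.expMem (s • Y)) X : Matrix N N A)) 0 0 := by
    simp_rw [hconst]
    exact hasDerivAt_const 0 (δ X)
  have h := hD.unique hD0
  -- `⁅Y, X⁆ = YX - XY` in `𝔥`
  have hbr : ((⁅Y, X⁆ : H.lie) : Matrix N N A) = (Y : Matrix N N A) * X - X * Y := by
    rw [LieSubalgebra.coe_bracket, Ring.lie_def]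
  rw [← hΔδ, hbr]
  exact h

end Bracket

end RealMatrixGroup

end Literature.NumberTheory.Automorphic
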